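import Literature.AlgebraicGeometry.VanGeemen1994.WeilTypeHodgeGroupSUEndomorphismField
import Literature.AlgebraicGeometry.VanGeemen1994.HodgeGroupLeSUWeilType
import Literature.AlgebraicGeometry.Milne1999.SimpleIsogenyFactorsUniqueness
import Literature.AlgebraicGeometry.Milne1999.CMTypeNonzeroHom
import Literature.AlgebraicGeometry.HodgeTheory.WeilTypeGeneralMemberPowersGeneralHodgeConjecture
import HarnessLib

/-!
# The general abelian variety of Weil type admits no non-zero homomorphism to or from an abelian variety without
# factor of type IV, or of CM type; and the Weil-type hypothesis of the powers theorems is discharged by `Hg = SU_H`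
# (Mumford §19; Moonen–Zarhin 1999 §1; van Geemen LNM 1594, 6.9–6.12; Abdulali 2016, App. A)

Family `hodge`, layer `Literature/AlgebraicGeometry/VanGeemen1994`; THEOREMS ONLY — no definition, no named fact, no
`sorry` (D-0026, net debt 0). Lane `lit-hodgefound` (Track 2 foundations library), prover seat `lit-hodgefound-p21`,
generation 30, row g30-#10; sequel of g30-#1 (`Milne1999/SimpleIsogenyFactorsUniqueness`), g30-#3
(`not_hasNoTypeIVFactor_of_hasHodgeGroupSU`), g30-#6 (`isSimple_of_hasHodgeGroupSU`, `not_isOfCMType_of_hasHodgeGroupSU`)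
and g30-#7 (`isOfHodgeType_of_mem_weilClassesOf_of_hasHodgeGroupSU`).

PUBLISHED STATEMENTS (held copies read). D. Mumford, *Abelian Varieties* §19, Cor. 1–2 of Thm. 1 (pp. 173–174): a
non-zero homomorphism between simple abelian varieties is an isogeny; `Hom⁰(X, Y) = 0` for non-isogenous simple `X, Y`,
and `X ↦ {simple factors}` is additive. B. Moonen, Yu. Zarhin, Math. Ann. 315 (1999) §1 (held `paper:arxiv-math_9901113`
p0002): the Albert type of a simple factor is an isogeny invariant; «no factors of Type 4». J. S. Milne, *Lefschetz
motives and the Tate conjecture* (1999) §2 p. 54: CM type is inherited by simple isogeny factors, images and quotients.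
S. Abdulali, *Tate twists of Hodge structures arising from abelian varieties* (2016), App. A item 1(b): HC / general HC for
the powers of the general member of a Weil-type family from the algebraicity of its Weil classes.

WHAT IS PROVED.
* §1 (any complex abelian varieties) `hom_eq_zero_of_isSimple_of_not_hasNoTypeIVFactor` /
  `hom_eq_zero_to_isSimple_of_not_hasNoTypeIVFactor` — a SIMPLE `A` WITH a factor of type IV has `Hom(A, S) = 0 = Hom(S, A)`
  for every `S` WITHOUT factor of type IV (a non-zero map makes `A` a simple isogeny factor of `S`, g30-#1, and those
  inherit «no type IV», g29 `HasNoTypeIVFactor.of_isSimpleIsogenyFactor`); `hom_eq_zero_of_isSimple_of_not_isOfCMType` /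
  `hom_eq_zero_to_isSimple_of_not_isOfCMType` — a simple NON-CM `A` has `Hom(A, C) = 0 = Hom(C, A)` for every `C` of CM
  type (tree `IsOfCMType.of_ne_zero_hom_from/to_isSimple`).
* §2 (the general member: `dim A = 2n`, `n ≥ 2`, `φ ≫ φ = -d`, `Hg = SU_H`) **`hom_eq_zero_of_hasHodgeGroupSU_of_hasNoTypeIVFactor`**,
  **`hom_eq_zero_to_of_hasHodgeGroupSU_of_hasNoTypeIVFactor`**, **`hom_eq_zero_of_hasHodgeGroupSU_of_isOfCMType`**,
  **`hom_eq_zero_to_of_hasHodgeGroupSU_of_isOfCMType`** (`Hom(A, S) = Hom(S, A) = 0` for `S` without type-IV factor or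
  of CM type — the `Hom`-vanishing hypotheses of the product lane's files `TimesGluedBlocksProductSpan`,
  `RealSl2Blocks…`, `NoTypeIVTimesCM…`), `not_isSimpleIsogenyFactor_of_hasHodgeGroupSU_…`,
  `not_isIsogenous_of_hasHodgeGroupSU_…`, and `isSimpleIsogenyFactor_iff_isIsogenous_of_hasHodgeGroupSU` (the only simple
  isogeny factor of `A` is `A`).
* §3 **THE WEIL-TYPE HYPOTHESIS OF THE POWERS THEOREMS IS DISCHARGED BY `Hg = SU_H`** (g30-#7):
  `hodgeConjectureFor_powSucc_of_hasHodgeGroupSU_of_weilClasses'`, `generalHodgePropertyFor_powSucc_of_hasHodgeGroupSU_of_weilClasses'`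
  — the tree's Abdulali App. A 1(b) mechanisms without the clause «the Weil classes are of type `(n,n)`».

HONESTY CLAUSE. `HasHodgeGroupSU` remains a hypothesis (Thm. 6.11's «general member» is a moduli statement); §3 stays
conditional on the vendored Abdulali facts BY NAME, exactly as the tree's unprimed theorems.

## References

* [MumfordAV1970] D. Mumford, *Abelian Varieties* (1970), §19 Cor. 1–2 of Thm. 1 (pp. 173–174). [cite: MumfordAV1970, §19 Cor. 1–2 (pp. 173–174)]
* [MoonenZarhin1999LowDim] B. Moonen, Yu. Zarhin, Math. Ann. 315 (1999), §1. [cite: MoonenZarhin1999LowDim, §1]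
* [Milne1999] J. S. Milne, *Lefschetz motives and the Tate conjecture*, Compositio Math. 117 (1999), §2 p. 54. [cite: Milne1999, §2 p. 54]
* [vanGeemen1994HodgeAV] B. van Geemen, LNM 1594 (1994), 6.9–6.12. [cite: vanGeemen1994HodgeAV, 6.9–6.12]
* [Abdulali2016TateTwists] S. Abdulali, *Tate twists of Hodge structures arising from abelian varieties*, in: Recent
  Advances in Hodge Theory (2016), App. A item 1(b). [cite: Abdulali2016TateTwists, App. A item 1(b)]
-/

noncomputable section

open CategoryTheory
open Literature.AlgebraicTopology.SingularHomology
open Literature.AlgebraicGeometry.Motives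
open Literature.AlgebraicGeometry.HodgeTheory
open Literature.AlgebraicGeometry.Milne1999

/-! ### §1 Simple abelian varieties with a factor of type IV, or not of CM type -/

namespace Literature.AlgebraicGeometry.HodgeTheory

variable {A S C : AbelianVariety ℂ}

/-- **A simple abelian variety with a factor of type IV has no non-zero map to an abelian variety without factor of
type IV** (`f ≠ 0` makes `A` a simple isogeny factor of `S`, which would have no type-IV factor).
[cite: MumfordAV1970, §19 Cor. 1–2 (pp. 173–174)] [cite: MoonenZarhin1999LowDim, §1] -/
theorem hom_eq_zero_of_isSimple_of_not_hasNoTypeIVFactor (hA : A.IsSimple) (hA0 : 0 < A.dim)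
    (h4 : ¬ HasNoTypeIVFactor A) (hS : HasNoTypeIVFactor S) (f : A ⟶ S) : f = 0 := by
  by_contra hf
  exact h4 (hS.of_isSimpleIsogenyFactor (isSimpleIsogenyFactor_of_hom_ne_zero hA hA0 f hf))

/-- … nor FROM such an abelian variety (`g ≠ 0` into the simple `A` again makes `A` a simple isogeny factor, g30-#1
`isSimpleIsogenyFactor_of_hom_ne_zero'`). [cite: MumfordAV1970, §19 Cor. 1–2 (pp. 173–174)] [cite: MoonenZarhin1999LowDim, §1] -/
theorem hom_eq_zero_to_isSimple_of_not_hasNoTypeIVFactor (hA : A.IsSimple) (hA0 : 0 < A.dim)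
    (h4 : ¬ HasNoTypeIVFactor A) (hS : HasNoTypeIVFactor S) (g : S ⟶ A) : g = 0 := by
  by_contra hg
  exact h4 (hS.of_isSimpleIsogenyFactor (isSimpleIsogenyFactor_of_hom_ne_zero' hA hA0 g hg))

/-- **A simple abelian variety not of CM type has no non-zero map to an abelian variety of CM type** (tree
`IsOfCMType.of_ne_zero_hom_from_isSimple`: the image is CM and isogenous to `A`). [cite: Milne1999, §2 p. 54]
[cite: MumfordAV1970, §19 Cor. 1–2 (pp. 173–174)] -/
theorem hom_eq_zero_of_isSimple_of_not_isOfCMType (hA : A.IsSimple) (hcm : ¬ IsOfCMType A) (hC : IsOfCMType C)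
    (f : A ⟶ C) : f = 0 := by
  by_contra hf
  exact hcm (hC.of_ne_zero_hom_from_isSimple hA f hf)

/-- … nor from one (tree `IsOfCMType.of_ne_zero_hom_to_isSimple`: `A` is a quotient of `C`). [cite: Milne1999, §2 p. 54]
[cite: MumfordAV1970, §19 Cor. 1–2 (pp. 173–174)] -/
theorem hom_eq_zero_to_isSimple_of_not_isOfCMType (hA : A.IsSimple) (hcm : ¬ IsOfCMType A) (hC : IsOfCMType C)
    (g : C ⟶ A) : g = 0 := by
  by_contra hg
  exact hcm (hC.of_ne_zero_hom_to_isSimple hA g hg)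

end Literature.AlgebraicGeometry.HodgeTheory

namespace Literature.AlgebraicGeometry.VanGeemen1994

/-! ### §2 The general member of the Weil family: `Hom` to and from type I–III and CM abelian varieties vanishes -/

section Package

variable (A : AbelianVariety ℂ) (φ : A ⟶ A) (n d : ℕ) (e : ProjectiveEmbedding A.X) (a : complexBetti (projectiveSpace e.n ℂ) 2)
  {S C B : AbelianVariety ℂ}

/-- **`Hom(A, S) = 0` for the general abelian variety of Weil type `A` (`Hg = SU_H`, `n ≥ 2`) and every `S` WITHOUT
factor of type IV** (`A` is simple with a factor of type IV, g30-#3/#6).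
[cite: MumfordAV1970, §19 Cor. 1–2 (pp. 173–174)] [cite: MoonenZarhin1999LowDim, §1] [cite: vanGeemen1994HodgeAV, 6.9 and Thm. 6.11] -/
theorem hom_eq_zero_of_hasHodgeGroupSU_of_hasNoTypeIVFactor (hn : 2 ≤ n) (hd : 0 < d) (hA : A.dim = 2 * n)
    (hφ : φ ≫ φ = -(d • 𝟙 A)) (ha : IsRationalClass a) (ha0 : a ≠ 0) (hSU : HasHodgeGroupSU A φ n d (hK d φ e a))
    (hS : HasNoTypeIVFactor S) (f : A ⟶ S) : f = 0 :=
  hom_eq_zero_of_isSimple_of_not_hasNoTypeIVFactor (isSimple_of_hasHodgeGroupSU A φ n d e a hn hd hA hφ ha ha0 hSU)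
    (by omega) (not_hasNoTypeIVFactor_of_hasHodgeGroupSU A φ n d e a hn hd hA hφ ha ha0 hSU) hS f

/-- **`Hom(S, A) = 0`** likewise. [cite: MumfordAV1970, §19 Cor. 1–2 (pp. 173–174)] [cite: MoonenZarhin1999LowDim, §1] -/
theorem hom_eq_zero_to_of_hasHodgeGroupSU_of_hasNoTypeIVFactor (hn : 2 ≤ n) (hd : 0 < d) (hA : A.dim = 2 * n)
    (hφ : φ ≫ φ = -(d • 𝟙 A)) (ha : IsRationalClass a) (ha0 : a ≠ 0) (hSU : HasHodgeGroupSU A φ n d (hK d φ e a))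
    (hS : HasNoTypeIVFactor S) (g : S ⟶ A) : g = 0 :=
  hom_eq_zero_to_isSimple_of_not_hasNoTypeIVFactor (isSimple_of_hasHodgeGroupSU A φ n d e a hn hd hA hφ ha ha0 hSU)
    (by omega) (not_hasNoTypeIVFactor_of_hasHodgeGroupSU A φ n d e a hn hd hA hφ ha ha0 hSU) hS g

/-- **`Hom(A, C) = 0` for the general abelian variety of Weil type `A` and every `C` OF CM TYPE** (`A` is simple and
not of CM type, g30-#6). [cite: Milne1999, §2 p. 54] [cite: vanGeemen1994HodgeAV, 6.9 and Thm. 6.11] -/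
theorem hom_eq_zero_of_hasHodgeGroupSU_of_isOfCMType (hn : 2 ≤ n) (hd : 0 < d) (hA : A.dim = 2 * n)
    (hφ : φ ≫ φ = -(d • 𝟙 A)) (ha : IsRationalClass a) (ha0 : a ≠ 0) (hSU : HasHodgeGroupSU A φ n d (hK d φ e a))
    (hC : IsOfCMType C) (f : A ⟶ C) : f = 0 :=
  hom_eq_zero_of_isSimple_of_not_isOfCMType (isSimple_of_hasHodgeGroupSU A φ n d e a hn hd hA hφ ha ha0 hSU)
    (not_isOfCMType_of_hasHodgeGroupSU A φ n d e a hn hd hA hφ ha ha0 hSU) hC f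

/-- **`Hom(C, A) = 0`** likewise. [cite: Milne1999, §2 p. 54] [cite: vanGeemen1994HodgeAV, 6.9 and Thm. 6.11] -/
theorem hom_eq_zero_to_of_hasHodgeGroupSU_of_isOfCMType (hn : 2 ≤ n) (hd : 0 < d) (hA : A.dim = 2 * n)
    (hφ : φ ≫ φ = -(d • 𝟙 A)) (ha : IsRationalClass a) (ha0 : a ≠ 0) (hSU : HasHodgeGroupSU A φ n d (hK d φ e a))
    (hC : IsOfCMType C) (g : C ⟶ A) : g = 0 :=
  hom_eq_zero_to_isSimple_of_not_isOfCMType (isSimple_of_hasHodgeGroupSU A φ n d e a hn hd hA hφ ha ha0 hSU)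
    (not_isOfCMType_of_hasHodgeGroupSU A φ n d e a hn hd hA hφ ha ha0 hSU) hC g

/-- The general member is not a simple isogeny factor of an abelian variety without type-IV factor …
[cite: MoonenZarhin1999LowDim, §1] [cite: MumfordAV1970, §19 Cor. 1–2 (pp. 173–174)] -/
theorem not_isSimpleIsogenyFactor_of_hasHodgeGroupSU_of_hasNoTypeIVFactor (hn : 2 ≤ n) (hd : 0 < d)
    (hA : A.dim = 2 * n) (hφ : φ ≫ φ = -(d • 𝟙 A)) (ha : IsRationalClass a) (ha0 : a ≠ 0)
    (hSU : HasHodgeGroupSU A φ n d (hK d φ e a)) (hS : HasNoTypeIVFactor S) : ¬ IsSimpleIsogenyFactor A S := fun h ↦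
  not_hasNoTypeIVFactor_of_hasHodgeGroupSU A φ n d e a hn hd hA hφ ha ha0 hSU (hS.of_isSimpleIsogenyFactor h)

/-- … nor of an abelian variety of CM type. [cite: Milne1999, §2 p. 54] -/
theorem not_isSimpleIsogenyFactor_of_hasHodgeGroupSU_of_isOfCMType (hn : 2 ≤ n) (hd : 0 < d) (hA : A.dim = 2 * n)
    (hφ : φ ≫ φ = -(d • 𝟙 A)) (ha : IsRationalClass a) (ha0 : a ≠ 0) (hSU : HasHodgeGroupSU A φ n d (hK d φ e a))
    (hC : IsOfCMType C) : ¬ IsSimpleIsogenyFactor A C := fun h ↦ by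
  obtain ⟨f, hf⟩ := h.exists_hom_ne_zero
  exact hf (hom_eq_zero_of_hasHodgeGroupSU_of_isOfCMType A φ n d e a hn hd hA hφ ha ha0 hSU hC f)

/-- The general member is not isogenous to an abelian variety without type-IV factor …
[cite: MoonenZarhin1999LowDim, §1] [cite: MumfordAV1970, §19 Cor. 1–2 (pp. 173–174)] -/
theorem not_isIsogenous_of_hasHodgeGroupSU_of_hasNoTypeIVFactor (hn : 2 ≤ n) (hd : 0 < d) (hA : A.dim = 2 * n)
    (hφ : φ ≫ φ = -(d • 𝟙 A)) (ha : IsRationalClass a) (ha0 : a ≠ 0) (hSU : HasHodgeGroupSU A φ n d (hK d φ e a))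
    (hS : HasNoTypeIVFactor S) : ¬ AbelianVariety.IsIsogenous A S := fun h ↦
  not_hasNoTypeIVFactor_of_hasHodgeGroupSU A φ n d e a hn hd hA hφ ha ha0 hSU (hS.of_isIsogenous h)

/-- … nor to an abelian variety of CM type. [cite: Milne1999, §2 p. 54] -/
theorem not_isIsogenous_of_hasHodgeGroupSU_of_isOfCMType (hn : 2 ≤ n) (hd : 0 < d) (hA : A.dim = 2 * n)
    (hφ : φ ≫ φ = -(d • 𝟙 A)) (ha : IsRationalClass a) (ha0 : a ≠ 0) (hSU : HasHodgeGroupSU A φ n d (hK d φ e a))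
    (hC : IsOfCMType C) : ¬ AbelianVariety.IsIsogenous A C := fun h ↦
  not_isOfCMType_of_hasHodgeGroupSU A φ n d e a hn hd hA hφ ha ha0 hSU ((isOfCMType_iff_of_isIsogenous h).2 hC)

/-- **The only simple isogeny factor of the general member is itself, up to isogeny** (`A` simple, g30-#6; g30-#1
`isSimpleIsogenyFactor_iff_isIsogenous_of_isSimple`). [cite: MumfordAV1970, §19 Cor. 1–2 (pp. 173–174)] -/
theorem isSimpleIsogenyFactor_iff_isIsogenous_of_hasHodgeGroupSU (hn : 2 ≤ n) (hd : 0 < d) (hA : A.dim = 2 * n)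
    (hφ : φ ≫ φ = -(d • 𝟙 A)) (ha : IsRationalClass a) (ha0 : a ≠ 0) (hSU : HasHodgeGroupSU A φ n d (hK d φ e a)) :
    IsSimpleIsogenyFactor B A ↔ B.IsSimple ∧ 0 < B.dim ∧ AbelianVariety.IsIsogenous B A :=
  ⟨fun h ↦ ⟨h.isSimple, h.dim_pos, h.isIsogenous_of_isSimple (isSimple_of_hasHodgeGroupSU A φ n d e a hn hd hA hφ ha ha0 hSU)⟩,
    fun ⟨_, _, hBA⟩ ↦ (isSimpleIsogenyFactor_iff_isIsogenous_of_isSimple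
      (isSimple_of_hasHodgeGroupSU A φ n d e a hn hd hA hφ ha ha0 hSU) (by omega)).2 hBA⟩

end Package

end Literature.AlgebraicGeometry.VanGeemen1994

/-! ### §3 The powers theorems without the Weil-type clause -/

namespace Literature.AlgebraicGeometry.HodgeTheory

open Literature.AlgebraicGeometry.VanGeemen1994

variable {A : AbelianVariety ℂ} {φ : A ⟶ A} {n d : ℕ}

/-- **Abdulali App. A item 1(b), mechanism, from `Hg = SU_H` alone**: for the general member (`n ≥ 2`) the algebraicity
of its rational `(n,n)` Weil classes gives HC for every power — the tree's
`hodgeConjectureFor_powSucc_of_hasHodgeGroupSU_of_weilClasses` with its clause «Weil classes of type `(n,n)`» discharged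
(g30-#7 `isOfHodgeType_of_mem_weilClassesOf_of_hasHodgeGroupSU`). [cite: Abdulali2016TateTwists, App. A item 1(b)]
[cite: vanGeemen1994HodgeAV, Thm. 6.11 and Thm. 6.12] -/
theorem hodgeConjectureFor_powSucc_of_hasHodgeGroupSU_of_weilClasses'
    (hAbd : Abdulali1999_hodgeClasses_algebraic_powSucc_of_hasHodgeGroupSU) (e : ProjectiveEmbedding A.X)
    {a : complexBetti (projectiveSpace e.n ℂ) 2} (hn : 2 ≤ n) (hd : 0 < d) (hA : A.dim = 2 * n)
    (hφ : φ ≫ φ = -(d • 𝟙 A)) (ha : IsRationalClass a) (ha0 : a ≠ 0)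
    (hSU : HasHodgeGroupSU A φ n d
      ((d : ℂ) • complexBetti.map e.ι 2 a + complexBetti.map φ.hom.hom.hom 2 (complexBetti.map e.ι 2 a)))
    (hR : ∀ c : complexBetti A.X (2 * n), IsRationalClass c → IsOfHodgeType (2 * n) A.X (2 * n) n n c →
      c ∈ weilClassesOf A φ n d → c ∈ algebraicClasses A.X n) (N : ℕ) :
    HodgeConjectureFor (A.powSucc N).dim (A.powSucc N).X :=
  hodgeConjectureFor_powSucc_of_hasHodgeGroupSU_of_weilClasses hAbd e hn hd hA hφ
    (fun _ hc ↦ isOfHodgeType_of_mem_weilClassesOf_of_hasHodgeGroupSU hd hA hφ hSU hc) ha ha0 hSU hR N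

/-- **Abdulali App. A item 1(b), general HC for the powers, from `Hg = SU_H` alone** (the tree's
`generalHodgePropertyFor_powSucc_of_hasHodgeGroupSU_of_weilClasses` without the Weil-type clause).
[cite: Abdulali2016TateTwists, App. A item 1(b)] [cite: vanGeemen1994HodgeAV, Thm. 6.11 and Thm. 6.12] -/
theorem generalHodgePropertyFor_powSucc_of_hasHodgeGroupSU_of_weilClasses'
    (hG : Abdulali2012_generalHodgeProperty_powSucc_of_hasHodgeGroupSU) (e : ProjectiveEmbedding A.X)
    {a : complexBetti (projectiveSpace e.n ℂ) 2} (hn : 2 ≤ n) (hd : 0 < d) (hA : A.dim = 2 * n)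
    (hφ : φ ≫ φ = -(d • 𝟙 A)) (ha : IsRationalClass a) (ha0 : a ≠ 0)
    (hSU : HasHodgeGroupSU A φ n d
      ((d : ℂ) • complexBetti.map e.ι 2 a + complexBetti.map φ.hom.hom.hom 2 (complexBetti.map e.ι 2 a)))
    (hR : ∀ c : complexBetti A.X (2 * n), IsRationalClass c → IsOfHodgeType (2 * n) A.X (2 * n) n n c →
      c ∈ weilClassesOf A φ n d → c ∈ algebraicClasses A.X n) (N i r : ℕ) :
    GeneralHodgePropertyFor (A.powSucc N).dim (A.powSucc N).X i r :=
  generalHodgePropertyFor_powSucc_of_hasHodgeGroupSU_of_weilClasses hG e hn hd hA hφ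
    (fun _ hc ↦ isOfHodgeType_of_mem_weilClassesOf_of_hasHodgeGroupSU hd hA hφ hSU hc) ha ha0 hSU hR N i r

end Literature.AlgebraicGeometry.HodgeTheory
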